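import Literature.AlgebraicTopology.SingularHomology.LocalHomologyCoeffExact
import Mathlib.RingTheory.Finiteness.Cardinality
import HarnessLib

/-!
# Integral generators of local homology generate over every coefficient ring

A. Hatcher, *Algebraic Topology*, CUP 2002, §3.3 p. 235: "In view of the canonical isomorphism
`Hₙ(M | x; R) ≈ Hₙ(M | x) ⊗ R` … an orientable manifold is `R`-orientable for all `R`": the image
`μₓ ⊗ 1` of a generator `μₓ` of `Hₙ(M | x) ≅ ℤ` is a generator of `Hₙ(M | x; R) ≅ R`.  This file
proves that statement for the concrete local homology `Hₙ(X | B; -)` of `…LocalHomology`, with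
`μ ⊗ 1` realised as the change-of-coefficient-group map `coeffMap (ℤ → R)` of
`…LocalHomologyCoeffChange` (the only form available across the universes of `ℤ` and `R`), and
WITHOUT the universal coefficient theorem: writing `Φ_A(a) := (k ↦ k • a)_* μ ∈ Hₙ(X | B; A)`
for a coefficient group `A` and `a ∈ A`,

* `clocalHomology.coeffElemHom B n μ : A →+ Hₙ(X | B; A)` is `Φ_A`, natural in `A`
  (`coeffMap_coeffElemHom`), with `Φ_ℤ(k) = k • μ` (`coeffElemHom_int`) and
  `Φ_R(r) = r • (ℤ → R)_* μ` (`coeffElemHom_ring`);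
* if `μ` generates `Hₙ(X | B; ℤ)` and `Hₙ₋₁(X | B; A') = 0` for all abelian groups `A'` (true at
  a point of an `n`-manifold, Hatcher p. 231), then `Φ_A` is ONTO for every coefficient module
  `A` over every ring in every universe (`clocalHomology.coeffElemHom_surjective`): for `ℤ`
  (`coeffElemHom_surjective_int`), along surjections `A ↠ A''` and extensions by the exactness of
  `…LocalHomologyCoeffExact` (`coeffElemHom_surjective_of_surjective`, `…_of_exact`), hence for
  `ℤᵐ` (`…_pi_fin`) and all finitely generated abelian groups (`…_of_finite`), and finally for
  arbitrary `A` because a relative cycle has finitely many coefficients, which lie in the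
  (injective) image of a finitely generated group `ℤᵐ/K` (a compactness argument);
* **`clocalHomology.exists_linearEquiv_coeffMap_intCast_eq_one`**: consequently, if moreover
  `Hₙ(X | B; R) ≃ₗ[R] R`, the class `(ℤ → R)_* μ` is a generator of `Hₙ(X | B; R)`
  (`Hₙ(X | B; R) = R • (ℤ → R)_* μ`), i.e. corresponds to `1` under some `R`-linear
  identification with `R` — Hatcher's "`μₓ ⊗ 1` is a generator".

Everything is proved; no named facts are introduced.  Consumer: `…OrientationProofs`
(`isOrientableOver_of_int`).

## References

* A. Hatcher, *Algebraic Topology*, CUP 2002, §3.3 p. 235 (and p. 231, §3.A Cor. 3A.4 for the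
  universal coefficient theorem which this argument replaces). [HatcherAT2002]
-/

noncomputable section

-- as in `SingularChainsConcrete`: chains of the concrete complex are `Finsupp`s up to unfolding
set_option backward.isDefEq.respectTransparency false

open CategoryTheory Limits

universe u v v' v'' w

namespace Literature.AlgebraicTopology.SingularHomology

namespace clocalHomology

variable {X : Type u} [TopologicalSpace X] (B : Set X) (n : ℕ) (μ : clocalHomology ℤ ℤ X B n)

section Elem

variable {R : Type v} [CommRing R] {R' : Type v'} [CommRing R'] {R'' : Type v''} [CommRing R'']
variable {A : Type v} [AddCommGroup A] [Module R A] {A' : Type v'} [AddCommGroup A'] [Module R' A']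
  {A'' : Type v''} [AddCommGroup A''] [Module R'' A'']

variable (R A) in
/-- **`Φ_A : A →+ Hₙ(X | B; A)`, `a ↦ (k ↦ k • a)_* μ`**: the image of the integral class `μ`
under the coefficient homomorphism `ℤ → A` determined by `a` (Hatcher 2002, §3.3 p. 235: for
`A = R` and `a = r` this is `μ ⊗ r ∈ Hₙ(M | x) ⊗ R ≈ Hₙ(M | x; R)`).
[cite: HatcherAT2002, §3.3 p. 235] -/
def coeffElemHom : A →+ clocalHomology R A X B n where
  toFun a := coeffMap ℤ R (zmultiplesHom A a) B n μ
  map_zero' := by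
    rw [show zmultiplesHom A (0 : A) = 0 from map_zero (zmultiplesAddHom A), coeffMap_zero,
      AddMonoidHom.zero_apply]
  map_add' a b := by
    rw [show zmultiplesHom A (a + b) = zmultiplesHom A a + zmultiplesHom A b from
      map_add (zmultiplesAddHom A) a b, coeffMap_add, AddMonoidHom.add_apply]

/-- `Φ_A(a) = (k ↦ k • a)_* μ`. [folklore] -/
lemma coeffElemHom_apply (a : A) :
    coeffElemHom B n μ R A a = coeffMap ℤ R (zmultiplesHom A a) B n μ := rfl

/-- **Naturality of `Φ`**: `g_* (Φ_A a) = Φ_{A'} (g a)` for an additive `g : A → A'`. [folklore] -/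
lemma coeffMap_coeffElemHom (g : A →+ A') (a : A) :
    coeffMap R R' g B n (coeffElemHom B n μ R A a) = coeffElemHom B n μ R' A' (g a) := by
  have hg : g.comp (zmultiplesHom A a) = zmultiplesHom A' (g a) :=
    AddMonoidHom.ext_int (by simp)
  rw [coeffElemHom_apply, coeffElemHom_apply, ← coeffMap_comp_apply (R' := R), hg]

variable (R) in
/-- `Φ_R(r) = r • (ℤ → R)_* μ` for a ring `R`: `μ ⊗ r = r (μ ⊗ 1)`. [folklore] -/
lemma coeffElemHom_ring (r : R) :
    coeffElemHom B n μ R R r = r • coeffMap ℤ R (Int.castAddHom R) B n μ := by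
  have hg : zmultiplesHom R r = (DistribSMul.toAddMonoidHom R r).comp (Int.castAddHom R) :=
    AddMonoidHom.ext_int (by simp)
  rw [coeffElemHom_apply, hg, coeffMap_comp_apply (R' := R), coeffMap_smul_apply]

/-- `Φ_ℤ(k) = k • μ` (the module action of `ℤ` on `Hₙ(X | B; ℤ)`). [folklore] -/
lemma coeffElemHom_int (k : ℤ) :
    coeffElemHom B n μ ℤ ℤ k = coeffMap ℤ ℤ (DistribSMul.toAddMonoidHom ℤ k) B n μ := by
  have hg : zmultiplesHom ℤ k = DistribSMul.toAddMonoidHom ℤ k := AddMonoidHom.ext_int (by simp)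
  rw [coeffElemHom_apply, hg]

variable {B n μ}

/-- If `μ` generates `Hₙ(X | B; ℤ)` (`e μ = 1` under an identification `e` with `ℤ`) then
`Φ_ℤ` is onto: `c = (e c) • μ`. [folklore] -/
lemma coeffElemHom_surjective_int (e : clocalHomology ℤ ℤ X B n ≃ₗ[ℤ] ℤ) (he : e μ = 1) :
    Function.Surjective (coeffElemHom B n μ ℤ ℤ) := fun c ↦ by
  refine ⟨e c, ?_⟩
  rw [coeffElemHom_int, coeffMap_smul_apply]
  -- `k • μ = e⁻¹ k`: both sides are `ℤ`-linear in `k` and agree at `k = 1`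
  have h1 : LinearMap.toSpanSingleton ℤ _ μ = e.symm.toLinearMap :=
    LinearMap.ext_ring (by
      rw [LinearMap.toSpanSingleton_apply_one, LinearEquiv.coe_coe, eq_comm,
        LinearEquiv.symm_apply_eq, he])
  have h2 := LinearMap.congr_fun h1 (e c)
  rw [LinearMap.toSpanSingleton_apply, LinearEquiv.coe_coe, LinearEquiv.symm_apply_apply] at h2
  exact h2

/-- **`Φ` is onto for an extension if it is onto for the ends**: for a short exact sequence of
coefficient groups `0 → A' →ᶠ A →ᵍ A'' → 0`, if `Φ_{A'}` and `Φ_{A''}` are onto then so is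
`Φ_A` (exactness of `Hₙ(X | B; A') → Hₙ(X | B; A) → Hₙ(X | B; A'')`,
`clocalHomology.exact_coeffMap`, and naturality of `Φ`). [folklore] -/
theorem coeffElemHom_surjective_of_exact {f : A' →+ A} {g : A →+ A''} (hf : Function.Injective f)
    (hfg : Function.Exact f g) (hg : Function.Surjective g)
    (h' : Function.Surjective (coeffElemHom B n μ R' A'))
    (h'' : Function.Surjective (coeffElemHom B n μ R'' A'')) :
    Function.Surjective (coeffElemHom B n μ R A) := by
  intro c
  obtain ⟨a'', ha''⟩ := h'' (coeffMap R R'' g B n c)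
  obtain ⟨a, rfl⟩ := hg a''
  have h0 : coeffMap R R'' g B n (c - coeffElemHom B n μ R A a) = 0 := by
    rw [map_sub, coeffMap_coeffElemHom, ha'', sub_self]
  obtain ⟨c', hc'⟩ := ((exact_coeffMap (R' := R') hf hfg hg B n) _).mp h0
  obtain ⟨a', rfl⟩ := h' c'
  refine ⟨a + f a', ?_⟩
  rw [map_add, ← coeffMap_coeffElemHom (R := R') (R' := R) B n μ f a', hc', add_sub_cancel]

end Elem

/-! ### Finitely generated coefficient groups -/

section FinitelyGenerated

variable {B n μ}

/-- **`Φ` is onto for quotients**: if `g : A ↠ A''` is a surjection of abelian groups (in `Type`)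
and `Hⱼ(X | B; A') = 0` for `j + 1 = n` and all abelian groups `A'`, then `Φ_{A''}` is onto if
`Φ_A` is (`Hₙ(X | B; A) → Hₙ(X | B; A'')` is onto, `coeffMap_surjective_of_isZero` with
`A' = ker g`). [folklore] -/
theorem coeffElemHom_surjective_of_surjective {A A'' : Type} [AddCommGroup A] [Module ℤ A]
    [AddCommGroup A''] [Module ℤ A''] (g : A →ₗ[ℤ] A'') (hg : Function.Surjective g)
    (hvan : ∀ (A' : Type) [AddCommGroup A'] [Module ℤ A'] (j : ℕ), j + 1 = n →
      IsZero (clocalHomology ℤ A' X B j))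
    (h : Function.Surjective (coeffElemHom B n μ ℤ A)) :
    Function.Surjective (coeffElemHom B n μ ℤ A'') := by
  intro c
  obtain ⟨a, ha⟩ := coeffMap_surjective_of_isZero (R' := ℤ) (R := ℤ) (R'' := ℤ)
    (f := (LinearMap.ker g).subtype.toAddMonoidHom) (g := g.toAddMonoidHom)
    Subtype.val_injective (LinearMap.exact_subtype_ker_map g) hg B n (hvan _) c
  obtain ⟨a₀, rfl⟩ := h a
  exact ⟨g a₀, by rw [← ha, coeffMap_coeffElemHom]; rfl⟩

/-- **`Φ` is onto for the free groups `ℤᵐ`** (induction on `m` along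
`0 → ℤ → ℤ × ℤᵐ → ℤᵐ → 0` and `ℤ × ℤᵐ ≅ ℤᵐ⁺¹`). [folklore] -/
theorem coeffElemHom_surjective_pi_fin
    (hvan : ∀ (A' : Type) [AddCommGroup A'] [Module ℤ A'] (j : ℕ), j + 1 = n →
      IsZero (clocalHomology ℤ A' X B j))
    (hμ : Function.Surjective (coeffElemHom B n μ ℤ ℤ)) :
    ∀ m : ℕ, Function.Surjective (coeffElemHom B n μ ℤ (Fin m → ℤ))
  | 0 => coeffElemHom_surjective_of_surjective (0 : ℤ →ₗ[ℤ] (Fin 0 → ℤ))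
      (fun _ ↦ ⟨0, Subsingleton.elim _ _⟩) hvan hμ
  | m + 1 =>
    coeffElemHom_surjective_of_surjective
      (Fin.consLinearEquiv ℤ (fun _ : Fin (m + 1) ↦ ℤ)).toLinearMap
      (Fin.consLinearEquiv ℤ (fun _ : Fin (m + 1) ↦ ℤ)).surjective hvan
      (coeffElemHom_surjective_of_exact (R := ℤ) (R' := ℤ) (R'' := ℤ) (A := ℤ × (Fin m → ℤ))
        (f := (LinearMap.inl ℤ ℤ (Fin m → ℤ)).toAddMonoidHom)
        (g := (LinearMap.snd ℤ ℤ (Fin m → ℤ)).toAddMonoidHom)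
        (show Function.Injective (LinearMap.inl ℤ ℤ (Fin m → ℤ)) from LinearMap.inl_injective)
        (show Function.Exact (LinearMap.inl ℤ ℤ (Fin m → ℤ)) (LinearMap.snd ℤ ℤ (Fin m → ℤ)) from
          Function.Exact.inl_snd)
        (show Function.Surjective (LinearMap.snd ℤ ℤ (Fin m → ℤ)) from LinearMap.snd_surjective)
        hμ (coeffElemHom_surjective_pi_fin hvan hμ m))

/-- **`Φ` is onto for every finitely generated abelian group** (a quotient of some `ℤᵐ`).
[folklore] -/
theorem coeffElemHom_surjective_of_finite
    (hvan : ∀ (A' : Type) [AddCommGroup A'] [Module ℤ A'] (j : ℕ), j + 1 = n →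
      IsZero (clocalHomology ℤ A' X B j))
    (hμ : Function.Surjective (coeffElemHom B n μ ℤ ℤ)) (A : Type) [AddCommGroup A] [Module ℤ A]
    [Module.Finite ℤ A] : Function.Surjective (coeffElemHom B n μ ℤ A) := by
  obtain ⟨m, f, hf⟩ := Module.Finite.exists_fin' ℤ A
  exact coeffElemHom_surjective_of_surjective f hf hvan (coeffElemHom_surjective_pi_fin hvan hμ m)

end FinitelyGenerated

/-! ### Arbitrary coefficient groups: finitely many coefficients -/

section General

variable {B n μ}
variable {S : Type w} [CommRing S] {A : Type w} [AddCommGroup A] [Module S A]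

/-- **`Φ_A` is onto for every coefficient module `A` over every ring, in every universe**, as soon
as `μ` generates `Hₙ(X | B; ℤ)` and `Hₙ₋₁(X | B; A') = 0` for all abelian groups `A'`: a relative
cycle `z` has finitely many coefficients; they lie in the image of an injective homomorphism
`ℤᵐ/K → A` from a finitely generated group, along which `z` lifts to a relative cycle
(`exists_relCls_eq_coeffMap_of_injective`), whose class is in the image of `Φ` by
`coeffElemHom_surjective_of_finite`; conclude by naturality of `Φ` (Hatcher 2002, §3.3 p. 235:
`Hₙ(M | x; R) = {±μₓ ⊗ r}`-structure of `M_R`). [folklore] -/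
theorem coeffElemHom_surjective
    (hvan : ∀ (A' : Type) [AddCommGroup A'] [Module ℤ A'] (j : ℕ), j + 1 = n →
      IsZero (clocalHomology ℤ A' X B j))
    (e : clocalHomology ℤ ℤ X B n ≃ₗ[ℤ] ℤ) (he : e μ = 1) :
    Function.Surjective (coeffElemHom B n μ S A) := by
  classical
  intro c
  obtain ⟨z, hz, rfl⟩ := (awaySub S A X B).relCls_surjective c
  change CChain A X n at z
  -- the finitely generated subgroup of `A` containing the coefficients of `z`
  let s : Finset A := z.frange
  let A₀ : Submodule ℤ A := Submodule.span ℤ (s : Set A)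
  haveI : Module.Finite ℤ A₀ := Module.Finite.span_of_finite ℤ s.finite_toSet
  obtain ⟨m, ψ, hψ⟩ := Module.Finite.exists_fin' ℤ (↥A₀)
  let φ : (Fin m → ℤ) →ₗ[ℤ] A := A₀.subtype ∘ₗ ψ
  -- a finitely generated group in `Type` mapping injectively onto `A₀`
  let A₁ : Type := (Fin m → ℤ) ⧸ LinearMap.ker φ
  let g : A₁ →ₗ[ℤ] A := (LinearMap.ker φ).liftQ φ le_rfl
  have hg : Function.Injective g :=
    LinearMap.ker_eq_bot.mp (Submodule.ker_liftQ_eq_bot _ _ _ le_rfl)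
  have hcoeff : ∀ σ, z σ ∈ Set.range g.toAddMonoidHom := by
    intro σ
    have hmem : z σ ∈ A₀ := by
      by_cases h0 : z σ = 0
      · rw [h0]; exact Submodule.zero_mem _
      · exact Submodule.subset_span (Finsupp.mem_frange.mpr ⟨h0, σ, rfl⟩)
    obtain ⟨p, hp⟩ := hψ ⟨_, hmem⟩
    refine ⟨Submodule.Quotient.mk p, ?_⟩
    change g (Submodule.Quotient.mk p) = _
    rw [Submodule.liftQ_apply, LinearMap.comp_apply, hp]
    rfl
  obtain ⟨z₁, hz₁, -, heq⟩ := exists_relCls_eq_coeffMap_of_injective (R' := ℤ) (R := S)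
    (f := g.toAddMonoidHom) hg B n z hz hcoeff
  obtain ⟨a₁, ha₁⟩ :=
    coeffElemHom_surjective_of_finite hvan (coeffElemHom_surjective_int e he) A₁
      ((awaySub ℤ A₁ X B).relCls z₁ hz₁)
  exact ⟨g a₁, by rw [← heq, ← ha₁, coeffMap_coeffElemHom]; rfl⟩

/-- **An integral generator is a generator over every ring** (Hatcher 2002, §3.3 p. 235: under
`Hₙ(M | x; R) ≈ Hₙ(M | x) ⊗ R` a generator `μₓ` of `Hₙ(M | x) ≅ ℤ` gives the generator `μₓ ⊗ 1`
of `Hₙ(M | x; R) ≅ R`; "an orientable manifold is `R`-orientable for all `R`").  If `μ` generates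
`Hₙ(X | B; ℤ)`, `Hₙ₋₁(X | B; A') = 0` for all abelian groups `A'`, and `Hₙ(X | B; R) ≃ₗ[R] R`,
then the image of `μ` under the coefficient map `ℤ → R` corresponds to `1 ∈ R` under some
`R`-linear identification `Hₙ(X | B; R) ≃ₗ[R] R`: indeed `Hₙ(X | B; R) = R • (ℤ → R)_* μ` by
`coeffElemHom_surjective`, so `(ℤ → R)_* μ ↦` a unit. [cite: HatcherAT2002, §3.3 p. 235] -/
theorem exists_linearEquiv_coeffMap_intCast_eq_one
    (hvan : ∀ (A' : Type) [AddCommGroup A'] [Module ℤ A'] (j : ℕ), j + 1 = n →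
      IsZero (clocalHomology ℤ A' X B j))
    (e : clocalHomology ℤ ℤ X B n ≃ₗ[ℤ] ℤ) (he : e μ = 1)
    (R : Type v) [CommRing R] (eR : clocalHomology R R X B n ≃ₗ[R] R) :
    ∃ e' : clocalHomology R R X B n ≃ₗ[R] R, e' (coeffMap ℤ R (Int.castAddHom R) B n μ) = 1 := by
  set b := coeffMap ℤ R (Int.castAddHom R) B n μ with hb
  obtain ⟨r, hr⟩ := coeffElemHom_surjective (S := R) (A := R) hvan e he (eR.symm 1)
  rw [coeffElemHom_ring] at hr
  have hu : IsUnit (eR b) := by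
    refine IsUnit.of_mul_eq_one r ?_
    rw [mul_comm, ← smul_eq_mul, ← map_smul, hr, LinearEquiv.apply_symm_apply]
  refine ⟨eR.trans (LinearEquiv.smulOfUnit hu.unit⁻¹), ?_⟩
  rw [LinearEquiv.trans_apply, LinearEquiv.smulOfUnit, DistribMulAction.toLinearEquiv_apply,
    Units.smul_def, smul_eq_mul]
  exact hu.val_inv_mul

end General

end clocalHomology

end Literature.AlgebraicTopology.SingularHomology
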